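import Literature.MathematicalPhysics.QuantumLattice.HubbardTTPrimeGrandCanonicalThermalStates
import HarnessLib

/-!
# Thermodynamic stability across thermal grand-canonical states and `μ`-cell density words

Family `hubbard` (topic `MathematicalPhysics/QuantumLattice`). Two short consequences of the Griffiths brackets of
`HubbardTTPrimeGrandCanonicalThermalStates` (for a thermal grand-canonical state `ω` at `(β; t,t',U; μ,h)`:
`βρ(ω)(μ₁ − μ) ≤ P(μ₁) − P(μ)`, `βm(ω)(h₁ − h) ≤ P(h₁) − P(h)`, `−βD(ω)(U₁ − U) ≤ P(U₁) − P(U)`, …,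
`P = gcPressureTT'Zeeman`):

* §1 THERMODYNAMIC STABILITY ACROSS STATES (add the two brackets of a pair of thermal states at two parameter values):
  density is MONOTONE in `μ` (`IsTorusLimitOfMixture.mul_sub_mul_density_sub_nonneg_of_gcGibbs`, `…density_le_density_…`),
  magnetisation in `h`, double occupancy ANTI-monotone in `U`, the `K`-energy anti-monotone in `β` (cooling lowers the
  energy), `K₂` anti-monotone in `t'`; and the magnetisation has the sign of the field (`βh·m(ω) ≥ 0`, evenness of `P`
  in `h`, `gcPressureTT'Zeeman_neg`).
* §2 `μ`-CELL WORDS («box ⊂ union of certified cells ⇒ word» on the chemical-potential axis): `P` is non-decreasing in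
  `μ` (`gcPressureTT'Zeeman_mono_mu`), so ONE floor `W ≤ P(μ₁)` at the left end of a cell `[μ₁, μ₂]` and ceilings
  `P(μ₀) ≤ q₀`, `P(μ₃) ≤ q₃` outside it (`μ₀ < μ₁`, `μ₂ < μ₃`) bound the density of EVERY thermal grand-canonical state at
  EVERY `μ` in the cell: `(W − q₀)/(β(μ₂ − μ₀)) ≤ ρ(ω) ≤ (q₃ − W)/(β(μ₃ − μ₂))`
  (`IsTorusLimitOfMixture.le_density_/density_le_of_gc_cell_of_gcGibbs`; pointwise lower form `sub_le_mul_density_…`).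

Everything is PROVED; no definition, no named fact, no sorry. WHAT THIS IS NOT: strict monotonicity / absence of
density jumps; a number of record.

## Mathlib / tree search

REUSED: `IsTorusLimitOfMixture.{mul_density,mul_magnetisation,neg_mul_docc,neg_mul_diagHop}_mul_sub_le_gcPressureTT'Zeeman_sub_of_gcGibbs`,
`…gcPressureTT'Zeeman_sub_le_sub_mul_energy_of_gcGibbs` (`HubbardTTPrimeGrandCanonicalThermalStates`), `gcPressureTT'Zeeman_le_iff`,
`pressureTT'₂_add_le_gcPressureTT'Zeeman`, `gcPressureTT'Zeeman_neg` (`HubbardTTPrimeGrandCanonicalPressureZeeman`); the `h = 0`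
monotonicity `gcPressureTT'_mono` exists (`…EnsembleEquivalence`), the Zeeman form is proved here.

## References

* R. B. Griffiths, J. Math. Phys. 5 (1964) 1215 (convexity; expectations as one-sided derivatives). [cite: Griffiths1964]
* D. Ruelle, *Statistical Mechanics: Rigorous Results* (1969), §3.4 (thermodynamic stability: density vs chemical potential). [cite: Ruelle1969, §3.4]
* R. B. Israel, *Convexity in the Theory of Lattice Gases* (1979), Thm. I.3.4. [cite: Israel1979, Thm. I.3.4]
* T. Koma, H. Tasaki, J. Stat. Phys. 76 (1994) 745, §1. [cite: KomaTasaki1994, §1]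
* E. H. Lieb, Phys. Rev. Lett. 62 (1989) 1201 (spin sectors / field). [cite: LiebPRL1989, proof of Theorem 1]
-/

noncomputable section

namespace Literature.MathematicalPhysics.QuantumLattice

open Matrix Finset HubbardWave0 Literature.Probability.LatticeModels ThermodynamicLimit LiebThm1
open _root_.Filter
open scoped _root_.Topology ComplexOrder BigOperators

namespace ThermodynamicLimit

section Mono

variable {β : ℝ} (hβ : 0 ≤ β) (t t' : ℝ) {U : ℝ} (hU : 0 ≤ U)
include hβ hU

/-- **The Zeeman grand-canonical pressure is non-decreasing in the chemical potential** (the sectors carry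
`x + y ≥ 0`). [cite: Ruelle1969, §3.4] -/
theorem gcPressureTT'Zeeman_mono_mu {μ₁ μ₂ : ℝ} (hμ : μ₁ ≤ μ₂) (hz : ℝ) :
    gcPressureTT'Zeeman β t t' U μ₁ hz ≤ gcPressureTT'Zeeman β t t' U μ₂ hz := by
  rw [gcPressureTT'Zeeman_le_iff hβ t t' hU]
  intro x y hx0 hx1 hy0 hy1
  have h := pressureTT'₂_add_le_gcPressureTT'Zeeman hβ t t' hU μ₂ hz hx0 hx1 hy0 hy1
  have hxy : 0 ≤ β * (μ₂ - μ₁) * (x + y) := by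
    have : 0 ≤ μ₂ - μ₁ := sub_nonneg.2 hμ
    positivity
  nlinarith

end Mono

end ThermodynamicLimit

namespace InfVolFermionState

section CrossState

variable {β : ℝ} (hβ : 0 ≤ β) (t t' : ℝ) {U : ℝ} (hU : 0 ≤ U) (μ hz : ℝ)
  {ω ω₁ : InfVolFermionState 2} {Ls Ls₁ : ℕ → ℕ}
include hβ hU

/-- **Density is monotone in the chemical potential across thermal grand-canonical states**: if `ω` is thermal at
`μ` and `ω₁` at `μ₁` (same `β, t, t', U, h`), then `β(μ₁ − μ)(ρ(ω₁) − ρ(ω)) ≥ 0` — add the two Griffiths brackets.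
[cite: Griffiths1964] [cite: Ruelle1969, §3.4] -/
theorem IsTorusLimitOfMixture.mul_sub_mul_density_sub_nonneg_of_gcGibbs
    (hω : ω.IsTorusLimitOfMixture sourcedGibbsCount (gcGibbsWeightTT' β t t' U μ hz)
      (gcGibbsVectorTT' t t' U μ hz) Ls)
    (hLs : Tendsto Ls atTop atTop) {μ₁ : ℝ}
    (hω₁ : ω₁.IsTorusLimitOfMixture sourcedGibbsCount (gcGibbsWeightTT' β t t' U μ₁ hz)
      (gcGibbsVectorTT' t t' U μ₁ hz) Ls₁)
    (hLs₁ : Tendsto Ls₁ atTop atTop) :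
    0 ≤ β * (μ₁ - μ) * (ω₁.density - ω.density) := by
  have h₁ := hω.mul_density_mul_sub_le_gcPressureTT'Zeeman_sub_of_gcGibbs hβ t t' hU μ hz hLs μ₁
  have h₂ := hω₁.mul_density_mul_sub_le_gcPressureTT'Zeeman_sub_of_gcGibbs hβ t t' hU μ₁ hz hLs₁ μ
  nlinarith

/-- Hence for `β > 0` and `μ < μ₁`: `ρ(ω) ≤ ρ(ω₁)`. [cite: Griffiths1964] [cite: Ruelle1969, §3.4] -/
theorem IsTorusLimitOfMixture.density_le_density_of_gcGibbs (hβ' : 0 < β)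
    (hω : ω.IsTorusLimitOfMixture sourcedGibbsCount (gcGibbsWeightTT' β t t' U μ hz)
      (gcGibbsVectorTT' t t' U μ hz) Ls)
    (hLs : Tendsto Ls atTop atTop) {μ₁ : ℝ} (hμ : μ < μ₁)
    (hω₁ : ω₁.IsTorusLimitOfMixture sourcedGibbsCount (gcGibbsWeightTT' β t t' U μ₁ hz)
      (gcGibbsVectorTT' t t' U μ₁ hz) Ls₁)
    (hLs₁ : Tendsto Ls₁ atTop atTop) :
    ω.density ≤ ω₁.density := by
  have h := hω.mul_sub_mul_density_sub_nonneg_of_gcGibbs hβ t t' hU μ hz hLs hω₁ hLs₁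
  have hpos : 0 < β * (μ₁ - μ) := mul_pos hβ' (sub_pos.2 hμ)
  nlinarith

/-- **Magnetisation is monotone in the field across thermal grand-canonical states**:
`β(h₁ − h)(m(ω₁) − m(ω)) ≥ 0`. [cite: Griffiths1964] [cite: Ruelle1969, §3.4] -/
theorem IsTorusLimitOfMixture.mul_sub_mul_magnetisation_sub_nonneg_of_gcGibbs
    (hω : ω.IsTorusLimitOfMixture sourcedGibbsCount (gcGibbsWeightTT' β t t' U μ hz)
      (gcGibbsVectorTT' t t' U μ hz) Ls)
    (hLs : Tendsto Ls atTop atTop) {h₁ : ℝ}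
    (hω₁ : ω₁.IsTorusLimitOfMixture sourcedGibbsCount (gcGibbsWeightTT' β t t' U μ h₁)
      (gcGibbsVectorTT' t t' U μ h₁) Ls₁)
    (hLs₁ : Tendsto Ls₁ atTop atTop) :
    0 ≤ β * (h₁ - hz) *
      (((ω₁.expect ({0} : Finset (Site 2)) (nAt 0 (Finset.mem_singleton_self 0) 0)).re -
          (ω₁.expect ({0} : Finset (Site 2)) (nAt 0 (Finset.mem_singleton_self 0) 1)).re) -
        ((ω.expect ({0} : Finset (Site 2)) (nAt 0 (Finset.mem_singleton_self 0) 0)).re -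
          (ω.expect ({0} : Finset (Site 2)) (nAt 0 (Finset.mem_singleton_self 0) 1)).re)) := by
  have h₁' := hω.mul_magnetisation_mul_sub_le_gcPressureTT'Zeeman_sub_of_gcGibbs hβ t t' hU μ hz hLs h₁
  have h₂ := hω₁.mul_magnetisation_mul_sub_le_gcPressureTT'Zeeman_sub_of_gcGibbs hβ t t' hU μ h₁ hLs₁ hz
  nlinarith

/-- **Double occupancy is anti-monotone in `U` across thermal grand-canonical states** (`U₁ ≥ 0`):
`β(U₁ − U)(D(ω₁) − D(ω)) ≤ 0`. [cite: Griffiths1964] [cite: KomaTasaki1994, §1] -/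
theorem IsTorusLimitOfMixture.mul_sub_mul_docc_sub_nonpos_of_gcGibbs
    (hω : ω.IsTorusLimitOfMixture sourcedGibbsCount (gcGibbsWeightTT' β t t' U μ hz)
      (gcGibbsVectorTT' t t' U μ hz) Ls)
    (hLs : Tendsto Ls atTop atTop) {U₁ : ℝ} (hU₁ : 0 ≤ U₁)
    (hω₁ : ω₁.IsTorusLimitOfMixture sourcedGibbsCount (gcGibbsWeightTT' β t t' U₁ μ hz)
      (gcGibbsVectorTT' t t' U₁ μ hz) Ls₁)
    (hLs₁ : Tendsto Ls₁ atTop atTop) :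
    β * (U₁ - U) *
        ((ω₁.expect ({0} : Finset (Site 2))
            (nAt 0 (Finset.mem_singleton_self 0) 0 * nAt 0 (Finset.mem_singleton_self 0) 1)).re -
          (ω.expect ({0} : Finset (Site 2))
            (nAt 0 (Finset.mem_singleton_self 0) 0 * nAt 0 (Finset.mem_singleton_self 0) 1)).re) ≤ 0 := by
  have h₁' := hω.neg_mul_docc_mul_sub_le_gcPressureTT'Zeeman_sub_of_gcGibbs hβ t t' hU μ hz hLs hU₁
  have h₂ := hω₁.neg_mul_docc_mul_sub_le_gcPressureTT'Zeeman_sub_of_gcGibbs hβ t t' hU₁ μ hz hLs₁ hU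
  nlinarith

/-- **The `K`-energy is anti-monotone in `β` across thermal grand-canonical states** (`β₁ ≥ 0`):
`(β₁ − β)(u(ω₁) − u(ω)) ≤ 0` — cooling lowers the energy. [cite: Griffiths1964] [cite: Israel1979, Thm. I.3.4] -/
theorem IsTorusLimitOfMixture.mul_sub_energy_sub_nonpos_of_gcGibbs
    (hω : ω.IsTorusLimitOfMixture sourcedGibbsCount (gcGibbsWeightTT' β t t' U μ hz)
      (gcGibbsVectorTT' t t' U μ hz) Ls)
    (hLs : Tendsto Ls atTop atTop) {β₁ : ℝ} (hβ₁ : 0 ≤ β₁)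
    (hω₁ : ω₁.IsTorusLimitOfMixture sourcedGibbsCount (gcGibbsWeightTT' β₁ t t' U μ hz)
      (gcGibbsVectorTT' t t' U μ hz) Ls₁)
    (hLs₁ : Tendsto Ls₁ atTop atTop) :
    (β₁ - β) *
        ((ω₁.meanEnergy (hubbardTTPrimeFermionInteraction t t' U) 1 - μ * ω₁.density -
            hz * ((ω₁.expect ({0} : Finset (Site 2)) (nAt 0 (Finset.mem_singleton_self 0) 0)).re -
              (ω₁.expect ({0} : Finset (Site 2)) (nAt 0 (Finset.mem_singleton_self 0) 1)).re)) -
          (ω.meanEnergy (hubbardTTPrimeFermionInteraction t t' U) 1 - μ * ω.density -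
            hz * ((ω.expect ({0} : Finset (Site 2)) (nAt 0 (Finset.mem_singleton_self 0) 0)).re -
              (ω.expect ({0} : Finset (Site 2)) (nAt 0 (Finset.mem_singleton_self 0) 1)).re))) ≤ 0 := by
  have h₁' := hω.gcPressureTT'Zeeman_sub_le_sub_mul_energy_of_gcGibbs hβ t t' hU μ hz hLs hβ₁
  have h₂ := hω₁.gcPressureTT'Zeeman_sub_le_sub_mul_energy_of_gcGibbs hβ₁ t t' hU μ hz hLs₁ hβ
  nlinarith

/-- **The diagonal-hopping energy is anti-monotone in `t'` across thermal grand-canonical states**: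
`β(t'₁ − t')(K₂(ω₁) − K₂(ω)) ≤ 0`. [cite: Griffiths1964] [cite: KomaTasaki1994, §1] -/
theorem IsTorusLimitOfMixture.mul_sub_mul_diagHop_sub_nonpos_of_gcGibbs
    (hω : ω.IsTorusLimitOfMixture sourcedGibbsCount (gcGibbsWeightTT' β t t' U μ hz)
      (gcGibbsVectorTT' t t' U μ hz) Ls)
    (hLs : Tendsto Ls atTop atTop) {t'₁ : ℝ}
    (hω₁ : ω₁.IsTorusLimitOfMixture sourcedGibbsCount (gcGibbsWeightTT' β t t'₁ U μ hz)
      (gcGibbsVectorTT' t t'₁ U μ hz) Ls₁)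
    (hLs₁ : Tendsto Ls₁ atTop atTop) :
    β * (t'₁ - t') * (ω₁.meanEnergy (hubbardTTPrimeFermionInteraction 0 1 0) 1 -
      ω.meanEnergy (hubbardTTPrimeFermionInteraction 0 1 0) 1) ≤ 0 := by
  have h₁' := hω.neg_mul_diagHop_mul_sub_le_gcPressureTT'Zeeman_sub_of_gcGibbs hβ t t' hU μ hz hLs t'₁
  have h₂ := hω₁.neg_mul_diagHop_mul_sub_le_gcPressureTT'Zeeman_sub_of_gcGibbs hβ t t'₁ hU μ hz hLs₁ t'
  nlinarith

/-- **The magnetisation has the sign of the field** (`P` is even in `h`): for a thermal grand-canonical state at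
field `h`, `β·h·m(ω) ≥ 0`. [cite: Griffiths1964] [cite: LiebPRL1989, proof of Theorem 1] -/
theorem IsTorusLimitOfMixture.mul_field_mul_magnetisation_nonneg_of_gcGibbs
    (hω : ω.IsTorusLimitOfMixture sourcedGibbsCount (gcGibbsWeightTT' β t t' U μ hz)
      (gcGibbsVectorTT' t t' U μ hz) Ls)
    (hLs : Tendsto Ls atTop atTop) :
    0 ≤ β * hz * ((ω.expect ({0} : Finset (Site 2)) (nAt 0 (Finset.mem_singleton_self 0) 0)).re -
      (ω.expect ({0} : Finset (Site 2)) (nAt 0 (Finset.mem_singleton_self 0) 1)).re) := by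
  have h := hω.mul_magnetisation_mul_sub_le_gcPressureTT'Zeeman_sub_of_gcGibbs hβ t t' hU μ hz hLs (-hz)
  rw [gcPressureTT'Zeeman_neg hβ t t' hU, sub_self] at h
  nlinarith

end CrossState

section Cells

variable {β : ℝ} (hβ : 0 ≤ β) (t t' : ℝ) {U : ℝ} (hU : 0 ≤ U) (μ hz : ℝ)
  {ω : InfVolFermionState 2} {Ls : ℕ → ℕ}
include hβ hU

/-- **μ-CELL DENSITY WORD (upper side)**: a floor `W ≤ P(μ₁)` at the left end of a cell `[μ₁, μ₂]` and a ceiling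
`P(μ₃) ≤ q₃` beyond its right end (`μ₂ < μ₃`) bound the density of EVERY thermal grand-canonical state at EVERY
`μ ∈ [μ₁, μ₂]`: `ρ(ω) ≤ (q₃ − W)/(β(μ₃ − μ₂))` (monotonicity of `P` in `μ` moves the floor to `μ`).
[cite: Griffiths1964] [cite: Ruelle1969, §3.4] -/
theorem IsTorusLimitOfMixture.density_le_of_gc_cell_of_gcGibbs (hβ' : 0 < β)
    (hω : ω.IsTorusLimitOfMixture sourcedGibbsCount (gcGibbsWeightTT' β t t' U μ hz)
      (gcGibbsVectorTT' t t' U μ hz) Ls)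
    (hLs : Tendsto Ls atTop atTop) {μ₁ μ₂ μ₃ W q₃ : ℝ} (h1 : μ₁ ≤ μ) (h2 : μ ≤ μ₂) (h3 : μ₂ < μ₃)
    (hW : W ≤ gcPressureTT'Zeeman β t t' U μ₁ hz) (hq : gcPressureTT'Zeeman β t t' U μ₃ hz ≤ q₃) :
    ω.density ≤ (q₃ - W) / (β * (μ₃ - μ₂)) := by
  have hsub := hω.mul_density_mul_sub_le_gcPressureTT'Zeeman_sub_of_gcGibbs hβ t t' hU μ hz hLs μ₃
  have hmono := gcPressureTT'Zeeman_mono_mu hβ t t' hU h1 hz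
  have hρ0 : 0 ≤ ω.density := by
    have h := hω.mul_density_mul_sub_le_gcPressureTT'Zeeman_sub_of_gcGibbs hβ t t' hU μ hz hLs (μ - 1)
    have hm := gcPressureTT'Zeeman_mono_mu hβ t t' hU (show μ - 1 ≤ μ by linarith) hz
    have hb : 0 ≤ β * ω.density := by nlinarith
    exact nonneg_of_mul_nonneg_right hb hβ'
  have haux : 0 ≤ β * ω.density * (μ₂ - μ) := mul_nonneg (mul_nonneg hβ hρ0) (sub_nonneg.2 h2)
  rw [le_div_iff₀ (mul_pos hβ' (by linarith))]
  nlinarith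

/-- **μ-CELL DENSITY WORD (lower side)**: a floor `W ≤ P(μ₁)` and a ceiling `P(μ₀) ≤ q₀` below the cell
(`μ₀ < μ₁ ≤ μ`) give `(W − q₀) ≤ βρ(ω)(μ − μ₀)` for every thermal grand-canonical state at `μ`; in particular
`(W − q₀)/(β(μ₂ − μ₀)) ≤ ρ(ω)` on the cell `μ ≤ μ₂`. [cite: Griffiths1964] [cite: Ruelle1969, §3.4] -/
theorem IsTorusLimitOfMixture.sub_le_mul_density_of_gc_cell_of_gcGibbs
    (hω : ω.IsTorusLimitOfMixture sourcedGibbsCount (gcGibbsWeightTT' β t t' U μ hz)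
      (gcGibbsVectorTT' t t' U μ hz) Ls)
    (hLs : Tendsto Ls atTop atTop) {μ₀ μ₁ W q₀ : ℝ} (h1 : μ₁ ≤ μ)
    (hW : W ≤ gcPressureTT'Zeeman β t t' U μ₁ hz) (hq : gcPressureTT'Zeeman β t t' U μ₀ hz ≤ q₀) :
    W - q₀ ≤ β * ω.density * (μ - μ₀) := by
  have hsub := hω.mul_density_mul_sub_le_gcPressureTT'Zeeman_sub_of_gcGibbs hβ t t' hU μ hz hLs μ₀
  have hmono := gcPressureTT'Zeeman_mono_mu hβ t t' hU h1 hz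
  nlinarith

/-- The uniform lower bound on the cell `[μ₁, μ₂]` (`β > 0`, `μ₀ < μ₁`): `(W − q₀)/(β(μ₂ − μ₀)) ≤ ρ(ω)` (trivial when
`W < q₀`, since `ρ(ω) ≥ 0`). [cite: Griffiths1964] [cite: Ruelle1969, §3.4] -/
theorem IsTorusLimitOfMixture.le_density_of_gc_cell_of_gcGibbs (hβ' : 0 < β)
    (hω : ω.IsTorusLimitOfMixture sourcedGibbsCount (gcGibbsWeightTT' β t t' U μ hz)
      (gcGibbsVectorTT' t t' U μ hz) Ls)
    (hLs : Tendsto Ls atTop atTop) {μ₀ μ₁ μ₂ W q₀ : ℝ} (h0 : μ₀ < μ₁) (h1 : μ₁ ≤ μ) (h2 : μ ≤ μ₂)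
    (hW : W ≤ gcPressureTT'Zeeman β t t' U μ₁ hz) (hq : gcPressureTT'Zeeman β t t' U μ₀ hz ≤ q₀) :
    (W - q₀) / (β * (μ₂ - μ₀)) ≤ ω.density := by
  have h := hω.sub_le_mul_density_of_gc_cell_of_gcGibbs hβ t t' hU μ hz hLs h1 hW hq
  have hρ0 : 0 ≤ ω.density := by
    have h' := hω.mul_density_mul_sub_le_gcPressureTT'Zeeman_sub_of_gcGibbs hβ t t' hU μ hz hLs (μ - 1)
    have hm := gcPressureTT'Zeeman_mono_mu hβ t t' hU (show μ - 1 ≤ μ by linarith) hz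
    have hb : 0 ≤ β * ω.density := by nlinarith
    exact nonneg_of_mul_nonneg_right hb hβ'
  have haux : 0 ≤ β * ω.density * (μ₂ - μ) := mul_nonneg (mul_nonneg hβ hρ0) (sub_nonneg.2 h2)
  rw [div_le_iff₀ (mul_pos hβ' (by linarith))]
  nlinarith

end Cells

end InfVolFermionState

end Literature.MathematicalPhysics.QuantumLattice

end
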